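import Summits.BirchSwinnertonDyer.BirchSwinnertonDyer.Theorems.ManinLocalTwoThreeTowerDescent
import Summits.BirchSwinnertonDyer.BirchSwinnertonDyer.Theorems.ManinLocalTwoThreeEulerFactorUnit
import Summits.BirchSwinnertonDyer.BirchSwinnertonDyer.Theorems.ManinLocalTwoThreeTowerReduction
import Literature.NumberTheory.EllipticCurves.NewformPeterssonSizeSymmSquareProofs

/-!
# E-an-135 `TowerUnitTwist p` ⟸ E-an-137 `UnipotentTowerGeneration p q N` — the tower unit-twist law from its f-free
# parent, for every prime `p` (MEMO-an §71.4–71.5; cell bsd-f2-manin, analytic lens g29); hence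
# E-es-66 / E-es-66₂ ⟸ modularity ∧ E-an-137

Summit `BirchSwinnertonDyer`, route `ManinLocalTwoThree`, cruxes C3 `ManinPrimeToThreeAtNine` (stmt-BirchSwinnertonDyer-22968,
input `h66`) / C2 `ManinOddAtFour` (stmt-…-22967, input `h66₂`).  Assembly of the chain
`…WieferichLevel` (LEMMA W) → `…TowerDescent` (Fourier descent) → `…EulerFactorUnit` (the Euler factor is a `p`-unit) →
`…TowerReduction` (E-an-136):

* `unipotentTowerGeneration_of_eventualLevelGeneration` — E-an-138 ⟹ E-an-137 (both by value) for `p ≠ 1`, the corrected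
  `EventualImpliesTower` edge.
* `exists_unitTwistAt_of_towerGeneration` — for the newform `f` of `W` with plus index prime to `p`, an odd prime `q ∤ N`,
  `q ≠ p`, `p ∤ (q-1)/2`, and the tower-generation law at `(f, q)` for every starting level: for every `n₁` some PRIMITIVE EVEN
  `χ` of conductor `qⁿ`, `n ≥ n₁`, satisfies `UnitTwistAt p W f χ` (Sketch-an-g29 §1, BY VALUE): `e_S(χ)·S_χ = r·Ω⁺_f` with
  `s·r/p` never an algebraic integer (`p ∤ s`).  The side conditions of MEMO-an §71.2 are discharged by LEMMA W at
  `x = ℓ^{p-1}`, `ℓ ∥ N` (so `χ(ℓ)^{p-1} ≠ 1`), by `a_ℓ(f)² = 1` at `ℓ ∥ N` (`IsNewform0.cuspCoeff_sq_eq_one_of_dvd_of_not_sq_dvd`,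
  no modularity needed) and by the cyclotomic cofactor of `…EulerFactorUnit`.
* `towerUnitTwist_of_unipotentTowerGeneration` — **E-an-135 `TowerUnitTwist p` BY VALUE ⟸ E-an-137 for all odd primes
  `q ∤ N`** (`UnipotentTowerGeneration p q N` BY VALUE, Sketch-an-g29 §4 verbatim).
* `threeAdicWitnessOfPlusIndexPrimeToThree_of_unipotentTowerGeneration`, `twoAdicWitnessOfPlusIndexOdd_of_unipotentTowerGeneration`
  — **E-es-66 ⟸ hnf ∧ E-an-137(3)**, **E-es-66₂ ⟸ hnf ∧ E-an-137(2)** BY NAME (through E-an-136, `…TowerReduction`).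

NOTE on levels: the tower law is instantiated at starting levels `≥ 2` only (at `n = 1` the Sketch's `levelDifferences` contains
`{∞, (b+t)/q} − {∞, b/q}` with `q ∣ b + t`, which is not a `Γ₁(N)`-period difference; harmless for E-an-137 as typed).
HONEST FRAMING: E-an-137 is a LAW (Ash–Stevens shape), taken as a hypothesis by value; modularity enters only the last two
corollaries.  C2/C3, Manin's conjecture and BSD are NOT proved by this.  No definitions, no named facts, no sorry.
-/

set_option linter.dupNamespace false
set_option autoImplicit false

noncomputable section

open scoped Classical MatrixGroups ModularForm ComplexConjugate

open CongruenceSubgroup Complex WeierstrassCurve Literature.NumberTheory.EllipticCurves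
  Literature.NumberTheory.EllipticCurves.ModularForms
  Summit.BirchSwinnertonDyer.Rank1Residual.ManinAdditive.KatoCurve

namespace Summit.BirchSwinnertonDyer.BirchSwinnertonDyer.Theorems.ManinLocalTwoThree

/-! ### §1 Products of `p`-unit factors with integral cofactors -/

/-- If every factor `e ℓ`, `ℓ ∈ S`, has an integral cofactor `c` with `e ℓ · c = t ∈ ℤ`, `p ∤ t`, then so does the product.
[folklore] -/
theorem exists_cofactor_prod_mul_eq_int {p : ℕ} (hp : p.Prime) (S : Finset ℕ) (e : ℕ → ℂ)
    (h : ∀ ℓ ∈ S, ∃ (c : ℂ) (t : ℤ), IsIntegral ℤ c ∧ e ℓ * c = t ∧ ¬ (p : ℤ) ∣ t) :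
    ∃ (c : ℂ) (t : ℤ), IsIntegral ℤ c ∧ (∏ ℓ ∈ S, e ℓ) * c = t ∧ ¬ (p : ℤ) ∣ t := by
  have h' : ∀ ℓ : ℕ, ∃ (c : ℂ) (t : ℤ), IsIntegral ℤ c ∧ ¬ (p : ℤ) ∣ t ∧ (ℓ ∈ S → e ℓ * c = t) := by
    intro ℓ
    by_cases hℓ : ℓ ∈ S
    · obtain ⟨c, t, hc, het, hpt⟩ := h ℓ hℓ
      exact ⟨c, t, hc, hpt, fun _ ↦ het⟩
    · exact ⟨0, 1, isIntegral_zero, by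
        rw [Int.natCast_dvd]; exact fun h1 ↦ hp.one_lt.ne' (Nat.dvd_one.mp h1), fun h1 ↦ (hℓ h1).elim⟩
  choose c t hc hpt het using h'
  refine ⟨∏ ℓ ∈ S, c ℓ, ∏ ℓ ∈ S, t ℓ, IsIntegral.prod _ (fun ℓ _ ↦ hc ℓ), ?_, ?_⟩
  · rw [← Finset.prod_mul_distrib, Int.cast_prod]
    exact Finset.prod_congr rfl fun ℓ hℓ ↦ het ℓ hℓ
  · rw [Prime.dvd_finsetProd_iff (Nat.prime_iff_prime_int.mp hp)]
    rintro ⟨ℓ, -, hℓ⟩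
    exact hpt ℓ hℓ

/-! ### §1b E-an-138 ⟹ E-an-137 (the edge `EventualImpliesTower` of Sketch-an-g29, corrected to `p ≠ 1`) -/

/-- **E-an-138 `EventualLevelGeneration q N` ⟹ E-an-137 `UnipotentTowerGeneration p q N`** (both BY VALUE, Sketch-an-g29 §4),
for every `p ≠ 1`, with multiplier `k = 1` (at the junk value `p = 1` the clause `¬ 1 ∣ k` is unsatisfiable while
`EventualLevelGeneration q 1` holds, so the Sketch's `EventualImpliesTower`, typed for all `p`, is false as stated — the
intended edge is this one). -/
theorem unipotentTowerGeneration_of_eventualLevelGeneration {p : ℕ} (hp : p ≠ 1) (q M : ℕ)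
    (hev : ∀ g : CuspForm (Gamma0 M) 2, ∃ n₂ : ℕ, ∀ n : ℕ, n₂ ≤ n →
      AddSubgroup.closure {z : ℂ | ∃ b t : ℤ, ¬ (q : ℤ) ∣ b ∧
        z = modularSymbol g (((b + t * (q : ℤ) ^ (n - 1) : ℤ) : ℚ) / (q : ℚ) ^ n) -
            modularSymbol g ((b : ℚ) / (q : ℚ) ^ n)} = periodLatticeGamma1 g) :
    ∀ (g : CuspForm (Gamma0 M) 2) (n₁ : ℕ), ∀ y ∈ periodLatticeGamma1 g,
      ∃ k : ℕ, ¬ p ∣ k ∧ (k : ℂ) * y ∈ AddSubgroup.closure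
        (⋃ (n : ℕ) (_ : n₁ ≤ n) (_ : 1 ≤ n), {z : ℂ | ∃ b t : ℤ, ¬ (q : ℤ) ∣ b ∧
          z = modularSymbol g (((b + t * (q : ℤ) ^ (n - 1) : ℤ) : ℚ) / (q : ℚ) ^ n) -
              modularSymbol g ((b : ℚ) / (q : ℚ) ^ n)}) := by
  intro g n₁ y hy
  obtain ⟨n₂, hn₂⟩ := hev g
  refine ⟨1, fun h ↦ hp (Nat.dvd_one.mp h), ?_⟩
  rw [Nat.cast_one, one_mul]
  have hy' : y ∈ AddSubgroup.closure {z : ℂ | ∃ b t : ℤ, ¬ (q : ℤ) ∣ b ∧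
      z = modularSymbol g (((b + t * (q : ℤ) ^ (max n₂ (max n₁ 1) - 1) : ℤ) : ℚ) / (q : ℚ) ^ (max n₂ (max n₁ 1))) -
          modularSymbol g ((b : ℚ) / (q : ℚ) ^ (max n₂ (max n₁ 1)))} := by
    rw [hn₂ _ (le_max_left _ _)]; exact hy
  refine AddSubgroup.closure_mono (fun z hz ↦ ?_) hy'
  simp only [Set.mem_iUnion]
  exact ⟨max n₂ (max n₁ 1), le_trans (le_max_left _ _) (le_max_right _ _),
    le_trans (le_max_right _ _) (le_max_right _ _), hz⟩

/-! ### §2 `UnitTwistAt p W f χ` in the `q`-tower from the tower-generation law -/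

variable {W : WeierstrassCurve ℚ} {N : ℕ} [NeZero N] {f : CuspForm (Gamma0 N) 2}

/-- **E-an-135 at `(W, f, q)` from E-an-137 at `(f, q)`** (MEMO-an §71.4–71.5): for the newform `f` of `W` with plus index prime
to the prime `p`, an odd prime `q ∤ N` with `q ≠ p`, `p ∤ (q-1)/2`, if for EVERY starting level the tower differences generate
`Λ₁(f)` up to prime-to-`p` index, then for every `n₁` some primitive even `χ` of conductor `qⁿ`, `n ≥ n₁`, satisfies
`UnitTwistAt p W f χ` (by value): the Euler-symmetrised twisted symbol sum is `r·Ω⁺_f` with `s·r/p` never an algebraic integer. -/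
theorem exists_unitTwistAt_of_towerGeneration (hWf : IsNewformOf W f) {p : ℕ} (hp : p.Prime) (hd : PlusIndexPrimeTo p f)
    {q : ℕ} [Fact q.Prime] (hq2 : q ≠ 2) (hqp : q ≠ p) (hqN : ¬ q ∣ N) (hpq : ¬ p ∣ (q - 1) / 2)
    (hgen : ∀ (n₁ : ℕ), ∀ y ∈ periodLatticeGamma1 f, ∃ k : ℕ, ¬ p ∣ k ∧ (k : ℂ) * y ∈ AddSubgroup.closure
      (⋃ (n : ℕ) (_ : n₁ ≤ n) (_ : 1 ≤ n), {z : ℂ | ∃ b t : ℤ, ¬ (q : ℤ) ∣ b ∧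
        z = modularSymbol f (((b + t * (q : ℤ) ^ (n - 1) : ℤ) : ℚ) / (q : ℚ) ^ n) -
            modularSymbol f ((b : ℚ) / (q : ℚ) ^ n)}))
    (n₁ : ℕ) :
    ∃ n : ℕ, n₁ ≤ n ∧ ∃ χ : DirichletCharacter ℂ (q ^ n), χ.IsPrimitive ∧ χ.Even ∧
      ∃ r : ℂ,
        (∏ ℓ ∈ N.primeFactors with ¬ ℓ ^ 2 ∣ N,
            (((ℓ : ℂ) - (W.LFunction ℓ : ℂ) * χ (ℓ : ZMod (q ^ n))) *
              ((ℓ : ℂ) - (W.LFunction ℓ : ℂ) * (χ (ℓ : ZMod (q ^ n)))⁻¹))) *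
            twistedSymbolSum f χ = r * (plusPeriod f : ℂ) ∧
        ∀ s : ℕ, ¬ p ∣ s → ¬ _root_.IsIntegral ℤ ((s : ℂ) * r / p) := by
  have hq : q.Prime := Fact.out
  have hf : IsNewform0 f := hWf.1
  have hQ : coeffField f = ⊥ := hWf.coeffField_eq_bot
  have hq3 : 3 ≤ q := by
    rcases hq.eq_two_or_odd' with h | h
    · exact absurd h hq2
    · have := hq.two_le; rcases h with ⟨k, hk⟩; omega
  have hqodd : q % 2 = 1 := hq.eq_two_or_odd.resolve_left hq2
  -- the Wieferich level of the multiplicative primes `ℓ ∥ N` at `x = ℓ^{p-1}`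
  set S : Finset ℕ := N.primeFactors.filter (fun ℓ ↦ ¬ ℓ ^ 2 ∣ N) with hS
  set nW : ℕ := S.sup (fun ℓ ↦ padicValNat q ((ℓ ^ (p - 1)) ^ (q - 1) - 1)) + 1 with hnW
  set n₀ : ℕ := max (max n₁ 2) nW with hn₀
  obtain ⟨n, hn, χ, r₀, hprim, hev, hr₀, hunit⟩ := exists_primitive_even_unit_twist_of_towerGeneration hf hQ hp hd hq2
    hqp hqN hpq (show 2 ≤ n₀ by omega) (hgen n₀)
  haveI : NeZero (q ^ n) := ⟨pow_ne_zero _ hq.ne_zero⟩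
  have hn1 : 1 ≤ n := by omega
  -- an exponent `d` prime to `p` killing `χ`: `d = q^{n-1}·(q-1)/2`
  set d : ℕ := q ^ (n - 1) * ((q - 1) / 2) with hdd
  have hχd : χ ^ d = 1 := pow_half_totient_eq_one_of_even hq hq2 hn1 hev
  have hd0 : 0 < d := Nat.mul_pos (pow_pos hq.pos _) (by omega)
  have hpd : ¬ p ∣ d := by
    intro h
    rcases (Nat.Prime.dvd_mul hp).mp h with h1 | h1
    · exact hqp ((Nat.prime_dvd_prime_iff_eq hp hq).mp (hp.dvd_of_dvd_pow h1)).symm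
    · exact hpq h1
  -- each Euler factor at `ℓ ∥ N` is a `p`-unit with an integral cofactor
  have hU : ∀ ℓ ∈ S, ∃ (c : ℂ) (t : ℤ), IsIntegral ℤ c ∧
      (((ℓ : ℂ) - (W.LFunction ℓ : ℂ) * χ (ℓ : ZMod (q ^ n))) *
        ((ℓ : ℂ) - (W.LFunction ℓ : ℂ) * (χ (ℓ : ZMod (q ^ n)))⁻¹)) * c = t ∧ ¬ (p : ℤ) ∣ t := by
    intro ℓ hℓS
    obtain ⟨hℓN, hℓ2⟩ := Finset.mem_filter.mp hℓS
    have hℓ : ℓ.Prime := Nat.prime_of_mem_primeFactors hℓN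
    have hℓdvd : ℓ ∣ N := Nat.dvd_of_mem_primeFactors hℓN
    -- `a_ℓ = ±1`
    have ha : W.LFunction ℓ = 1 ∨ W.LFunction ℓ = -1 := by
      have h1 := hf.cuspCoeff_sq_eq_one_of_dvd_of_not_sq_dvd hℓ hℓdvd hℓ2
      rw [hWf.2 ℓ] at h1
      have h2 : (W.LFunction ℓ) ^ 2 = 1 := by exact_mod_cast h1
      exact sq_eq_one_iff.mp h2
    -- `ζ = χ(ℓ)`: `ζ^d = 1`
    have hqℓ : ¬ q ∣ ℓ := fun h ↦ hqN (((Nat.prime_dvd_prime_iff_eq hq hℓ).mp h) ▸ hℓdvd)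
    have hℓunit : IsUnit ((ℓ : ℕ) : ZMod (q ^ n)) :=
      (ZMod.isUnit_iff_coprime ℓ (q ^ n)).mpr
        (Nat.Coprime.pow_right _ (Nat.coprime_comm.mp ((Nat.Prime.coprime_iff_not_dvd hq).mpr hqℓ)))
    obtain ⟨u, hu⟩ := hℓunit
    have hζd : χ (ℓ : ZMod (q ^ n)) ^ d = 1 := by
      rw [← hu, ← MulChar.pow_apply_coe, hχd, MulChar.one_apply_coe]
    -- LEMMA W at `x = ℓ^{p-1}`: `χ(ℓ)^{p-1} ≠ 1`
    have hζp : χ (ℓ : ZMod (q ^ n)) ^ (p - 1) ≠ 1 := by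
      have hx1 : 1 < ℓ ^ (p - 1) := Nat.one_lt_pow (by have := hp.two_le; omega) hℓ.one_lt
      have hqx : ¬ q ∣ ℓ ^ (p - 1) := fun h ↦ hqℓ (hq.dvd_of_dvd_pow h)
      have hlev : padicValNat q ((ℓ ^ (p - 1)) ^ (q - 1) - 1) < n := by
        have h1 : padicValNat q ((ℓ ^ (p - 1)) ^ (q - 1) - 1) ≤
            S.sup (fun ℓ ↦ padicValNat q ((ℓ ^ (p - 1)) ^ (q - 1) - 1)) :=
          Finset.le_sup (f := fun ℓ ↦ padicValNat q ((ℓ ^ (p - 1)) ^ (q - 1) - 1)) hℓS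
        omega
      have hW := wieferichLevel q (ℓ ^ (p - 1)) n hq hq2 hx1 hqx hlev χ hprim
      rwa [Nat.cast_pow, map_pow] at hW
    -- `χ(ℓ)² ≠ 1`
    have hζ2 : χ (ℓ : ZMod (q ^ n)) ^ 2 ≠ 1 := by
      intro h2
      by_cases hp2 : p = 2
      · subst hp2
        have hζ1 : χ (ℓ : ZMod (q ^ n)) ≠ 1 := by simpa using hζp
        have hneg : χ (ℓ : ZMod (q ^ n)) = -1 := (sq_eq_one_iff.mp h2).resolve_left hζ1
        have hdodd : Odd d := Nat.odd_iff.mpr (Nat.two_dvd_ne_zero.mp hpd)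
        rw [hneg, hdodd.neg_one_pow] at hζd
        norm_num at hζd
      · have h2p : 2 ∣ p - 1 := by
          rcases hp.eq_two_or_odd with h | h
          · exact absurd h hp2
          · omega
        obtain ⟨k, hk⟩ := h2p
        apply hζp
        rw [hk, pow_mul, h2, one_pow]
    exact exists_cofactor_mul_eq_int_of_pow_ne_one hp ℓ ha hd0 hpd hζd hζp hζ2
  obtain ⟨C, T, hC, hET, hpT⟩ := exists_cofactor_prod_mul_eq_int hp S
    (fun ℓ ↦ ((ℓ : ℂ) - (W.LFunction ℓ : ℂ) * χ (ℓ : ZMod (q ^ n))) *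
      ((ℓ : ℂ) - (W.LFunction ℓ : ℂ) * (χ (ℓ : ZMod (q ^ n)))⁻¹)) hU
  refine ⟨n, by omega, χ, hprim, hev,
    (∏ ℓ ∈ S, ((ℓ : ℂ) - (W.LFunction ℓ : ℂ) * χ (ℓ : ZMod (q ^ n))) *
      ((ℓ : ℂ) - (W.LFunction ℓ : ℂ) * (χ (ℓ : ZMod (q ^ n)))⁻¹)) * r₀, ?_, ?_⟩
  · rw [hr₀, mul_assoc]
  · exact not_isIntegral_mul_of_cofactor hp hC hET hpT hunit

/-! ### §3 E-an-135 `TowerUnitTwist p` from E-an-137 (by value) -/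

/-- **E-an-135 `TowerUnitTwist p` (BY VALUE, Sketch-an-g29 §2) ⟸ E-an-137 `UnipotentTowerGeneration p q N` (BY VALUE, §4) for
all odd primes `q ∤ N`** — the q-tower unit-twist law follows from its f-free parent, for every prime `p`
(MEMO-an §71.3–71.5 (a): Fourier descent + LEMMA W + cyclotomic cofactors). -/
theorem towerUnitTwist_of_unipotentTowerGeneration {p : ℕ} (hp : p.Prime)
    (hgen : ∀ (q N : ℕ) [NeZero N], q.Prime → q ≠ 2 → ¬ q ∣ N →
      ∀ (f : CuspForm (Gamma0 N) 2) (n₁ : ℕ), ∀ y ∈ periodLatticeGamma1 f,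
        ∃ k : ℕ, ¬ p ∣ k ∧ (k : ℂ) * y ∈ AddSubgroup.closure
          (⋃ (n : ℕ) (_ : n₁ ≤ n) (_ : 1 ≤ n), {z : ℂ | ∃ b t : ℤ, ¬ (q : ℤ) ∣ b ∧
            z = modularSymbol f (((b + t * (q : ℤ) ^ (n - 1) : ℤ) : ℚ) / (q : ℚ) ^ n) -
                modularSymbol f ((b : ℚ) / (q : ℚ) ^ n)})) :
    ∀ (W : WeierstrassCurve ℚ) [W.IsElliptic] {N : ℕ} [NeZero N] (f : CuspForm (Gamma0 N) 2),
      IsNewformOf W f → PlusIndexPrimeTo p f →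
      ∀ (q : ℕ) [Fact q.Prime], q ≠ 2 → q ≠ p → ¬ q ∣ N → ¬ p ∣ (q - 1) / 2 →
      ∀ n₁ : ℕ, ∃ n : ℕ, n₁ ≤ n ∧
        ∃ χ : DirichletCharacter ℂ (q ^ n), χ.IsPrimitive ∧ χ.Even ∧
          ∃ r : ℂ,
            (∏ ℓ ∈ N.primeFactors with ¬ ℓ ^ 2 ∣ N,
                (((ℓ : ℂ) - (W.LFunction ℓ : ℂ) * χ (ℓ : ZMod (q ^ n))) *
                  ((ℓ : ℂ) - (W.LFunction ℓ : ℂ) * (χ (ℓ : ZMod (q ^ n)))⁻¹))) *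
                twistedSymbolSum f χ = r * (plusPeriod f : ℂ) ∧
            ∀ s : ℕ, ¬ p ∣ s → ¬ _root_.IsIntegral ℤ ((s : ℂ) * r / p) := by
  intro W _ N _ f hWf hd q _ hq2 hqp hqN hpq n₁
  exact exists_unitTwistAt_of_towerGeneration hWf hp hd hq2 hqp hqN hpq
    (fun n₁' ↦ hgen q N Fact.out hq2 hqN f n₁') n₁

/-! ### §4 E-es-66 / E-es-66₂ from modularity and E-an-137 -/

/-- **E-es-66 ⟸ modularity ∧ E-an-137(3)**: if for every odd prime `q ∤ N` the `q`-tower differences generate `Λ₁(f)` up to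
prime-to-`3` index (`UnipotentTowerGeneration 3 q N` by value), then `ThreeAdicWitnessOfPlusIndexPrimeToThree` holds
(through E-an-135 and E-an-136). [cite: DiamondShurman2005, Thm. 8.8.1] -/
theorem threeAdicWitnessOfPlusIndexPrimeToThree_of_unipotentTowerGeneration (hnf : exists_isNewformOf)
    (hgen : ∀ (q N : ℕ) [NeZero N], q.Prime → q ≠ 2 → ¬ q ∣ N →
      ∀ (f : CuspForm (Gamma0 N) 2) (n₁ : ℕ), ∀ y ∈ periodLatticeGamma1 f,
        ∃ k : ℕ, ¬ 3 ∣ k ∧ (k : ℂ) * y ∈ AddSubgroup.closure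
          (⋃ (n : ℕ) (_ : n₁ ≤ n) (_ : 1 ≤ n), {z : ℂ | ∃ b t : ℤ, ¬ (q : ℤ) ∣ b ∧
            z = modularSymbol f (((b + t * (q : ℤ) ^ (n - 1) : ℤ) : ℚ) / (q : ℚ) ^ n) -
                modularSymbol f ((b : ℚ) / (q : ℚ) ^ n)})) :
    ThreeAdicWitnessOfPlusIndexPrimeToThree :=
  threeAdicWitnessOfPlusIndexPrimeToThree_of_towerUnitTwist' hnf
    (towerUnitTwist_of_unipotentTowerGeneration Nat.prime_three hgen)

/-- **E-es-66₂ ⟸ modularity ∧ E-an-137(2)**: the `p = 2` twin. [cite: DiamondShurman2005, Thm. 8.8.1] -/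
theorem twoAdicWitnessOfPlusIndexOdd_of_unipotentTowerGeneration (hnf : exists_isNewformOf)
    (hgen : ∀ (q N : ℕ) [NeZero N], q.Prime → q ≠ 2 → ¬ q ∣ N →
      ∀ (f : CuspForm (Gamma0 N) 2) (n₁ : ℕ), ∀ y ∈ periodLatticeGamma1 f,
        ∃ k : ℕ, ¬ 2 ∣ k ∧ (k : ℂ) * y ∈ AddSubgroup.closure
          (⋃ (n : ℕ) (_ : n₁ ≤ n) (_ : 1 ≤ n), {z : ℂ | ∃ b t : ℤ, ¬ (q : ℤ) ∣ b ∧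
            z = modularSymbol f (((b + t * (q : ℤ) ^ (n - 1) : ℤ) : ℚ) / (q : ℚ) ^ n) -
                modularSymbol f ((b : ℚ) / (q : ℚ) ^ n)})) :
    TwoAdicWitnessOfPlusIndexOdd :=
  twoAdicWitnessOfPlusIndexOdd_of_towerUnitTwist' hnf
    (towerUnitTwist_of_unipotentTowerGeneration Nat.prime_two hgen)

end Summit.BirchSwinnertonDyer.BirchSwinnertonDyer.Theorems.ManinLocalTwoThree

end
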